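import Literature.NumberTheory.Sieve.FouvryTenenbaumLiouville
import Literature.NumberTheory.Sieve.BombieriVinogradovMoebius
import Literature.NumberTheory.LFunctions.SiegelWalfiszLiouville
import HarnessLib

/-!
# Fouvry–Tenenbaum 2021, Theorem 1.8 for the Liouville function — PROVED

Topic `Literature/NumberTheory/Sieve`; sibling proofs file of `FouvryTenenbaumLiouville.lean`, closing
the named fact `Literature.NumberTheory.Sieve.FouvryTenenbaum2021_thm18_liouville` (É. Fouvry,
G. Tenenbaum, *Multiplicative functions in large arithmetic progressions and applications*, Trans.
Amer. Math. Soc. 375 (2022), Theorem 1.8, PDF p. 9, at `D = 1`, `K = 1`, `f = λ`): the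
Bombieri–Vinogradov theorem for the Liouville function,

  `∀ A > 0, ∃ B C, ∀ x ≥ 1, Q ≤ x^{1/2}/(log 3x)^B, (a_q, q) = 1:`
  `   ∑_{q ≤ Q} |∑_{n ≤ x, n ≡ a_q (q)} λ(n) − φ(q)⁻¹ ∑_{n ≤ x, (n,q)=1} λ(n)| ≤ C x/(log 3x)^A`

(`FouvryTenenbaum2021_thm18_liouville_holds`).  Everything here is PROVED (theorems only).

## The argument

The printed proof (FT §8, PDF p. 35) is a sketch resting on the paper's general machinery for the
class `𝓕(D, K)`; for `f = λ` we deduce the theorem from the Möbius case, itself proved in the tree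
by Vaughan's method (`Literature.NumberTheory.Sieve.bombieriVinogradov_moebius`,
`BombieriVinogradovMoebius.lean`):

* `λ = 𝟙_□ ⋆ μ`: for any predicate `P`, `∑_{n ≤ N, P(n)} λ(n) = ∑_{s ≤ N} 𝟙_□(s) ∑_{m ≤ N/s, P(sm)} μ(m)`
  (`sum_liouville_filter_eq`, from the tree's `SiegelWalfiszLiouville.liouville_eq_sum_antidiagonal`);
  for `(a, q) = 1` the inner sums over `sm ≡ a (q)` and over `(sm, q) = 1` are the Möbius sums in the
  class `a s̄` and in the coprime class when `(s, q) = 1`, and are empty otherwise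
  (`inner_progression_eq`, `inner_coprime_eq`), whence
  `Δ_λ(x; q, a) = ∑_{s ≤ x, s = □, (s,q)=1} Δ_μ(⌊x⌋/s; q, a s̄)` (`liouvilleAPDelta_eq`,
  `abs_liouvilleAPDelta_le_sum_sq`);
* the squares `k² ≤ (log x)^{2A+4}` are handled by the Bombieri–Vinogradov theorem for `μ` at the
  cut-offs `⌊x⌋/k²` with saving `(log x)^{2A+2}`, the larger squares by the trivial bound
  `|Δ_μ(M; q, b)| ≤ M/q + 1 + M/φ(q)` (`abs_moebiusDisc_le_trivial`, `sum_abs_moebiusDisc_le_trivial`,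
  `∑_{k > K} 1/k² ≤ 1/K`): `sum_abs_liouvilleAPDelta_le_of_large`;
* the passage from `log x` to `ℒ = log 3x` costs `2^A`, and bounded `x` are absorbed into the constant
  by the trivial bound `|Δ_λ(x; q, a)| ≤ 2x` (the tree's `abs_liouvilleAPDelta_le` of the def file).

## References

* É. Fouvry, G. Tenenbaum, Trans. Amer. Math. Soc. 375 (2022), 245–299, Theorem 1.8 (PDF p. 9) and
  §8 (PDF p. 35). [FouvryTenenbaum2021]
* H. Iwaniec, E. Kowalski, *Analytic Number Theory*, AMS 2004, Theorem 17.4 (the classical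
  Bombieri–Vinogradov theorem for convolutions). [IwaniecKowalski2004]
-/

namespace Literature.NumberTheory.Sieve

namespace FTLiouville

open Finset Real ArithmeticFunction BVMoebius
open scoped ArithmeticFunction.Moebius
open Literature.NumberTheory.LFunctions.SiegelWalfiszLiouville (liouville_eq_sum_antidiagonal
  sum_Ioc_inv_sq_le filter_isSquare_Ioc_eq_image)

/-! ### `λ = 𝟙_□ ⋆ μ` in a set of integers cut out by a predicate -/

/-- `∑_{n ≤ N, P(n)} λ(n) = ∑_{s ≤ N} 𝟙_□(s) ∑_{m ≤ N/s, P(sm)} μ(m)` for any predicate `P` (the tree's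
`SiegelWalfiszLiouville.sum_liouville_progression_eq` is the case `P(n) = [n ≡ a (q)]`). [folklore] -/
theorem sum_liouville_filter_eq (P : ℕ → Prop) [DecidablePred P] (N : ℕ) :
    ∑ n ∈ (Icc 1 N).filter P, (liouville n : ℝ) =
      ∑ s ∈ Ioc 0 N, (if IsSquare s then (1 : ℝ) else 0) *
        ∑ m ∈ (Ioc 0 (N / s)).filter (fun m => P (s * m)), (μ m : ℝ) := by
  have hIcc : Icc 1 N = Ioc 0 N := rfl
  rw [hIcc, sum_filter]
  have h1 : ∀ n ∈ Ioc 0 N, (if P n then (liouville n : ℝ) else 0)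
      = ∑ x ∈ n.divisorsAntidiagonal,
          (if P (x.1 * x.2) then (if IsSquare x.1 then (1 : ℝ) else 0) * (μ x.2 : ℝ) else 0) := by
    intro n hn
    rw [liouville_eq_sum_antidiagonal n]
    split_ifs with h
    · refine sum_congr rfl fun x hx => ?_
      rw [Nat.mem_divisorsAntidiagonal] at hx
      rw [hx.1, if_pos h]
    · symm
      refine sum_eq_zero fun x hx => ?_
      rw [Nat.mem_divisorsAntidiagonal] at hx
      rw [hx.1, if_neg h]
  rw [sum_congr rfl h1]
  refine (Vaughan.sum_Ioc_sum_divisorsAntidiagonal_eq (fun s m => if P (s * m) then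
    (if IsSquare s then (1 : ℝ) else 0) * (μ m : ℝ) else 0) N).trans ?_
  refine sum_congr rfl fun s _ => ?_
  rw [sum_filter, mul_sum]
  refine sum_congr rfl fun m _ => ?_
  split_ifs <;> simp

/-! ### The inner sums are Möbius sums in a progression / a coprimality class, or empty -/

/-- For `(a, q) = 1`: `∑_{m ≤ M, sm ≡ a (q)} μ(m) = M_μ(M; q, a s̄)` if `(s, q) = 1`, and `= 0` (empty)
otherwise. [folklore] -/
theorem inner_progression_eq {q : ℕ} {a : ZMod q} (ha : IsUnit a) (s M : ℕ) :
    ∑ m ∈ (Ioc 0 M).filter (fun m : ℕ => ((s * m : ℕ) : ZMod q) = a), (μ m : ℝ) =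
      if s.Coprime q then moebiusAPSum M q (a * ((s : ZMod q))⁻¹) else 0 := by
  split_ifs with h
  · have hs : IsUnit ((s : ZMod q)) := (ZMod.isUnit_iff_coprime s q).2 h
    rw [moebiusAPSum, show Icc 1 M = Ioc 0 M from rfl]
    refine sum_congr (Finset.filter_congr fun m _ => ?_) fun _ _ => rfl
    rw [Nat.cast_mul]
    constructor
    · intro hm
      rw [← hm, mul_comm ((s : ZMod q)) (m : ZMod q), mul_assoc, ZMod.mul_inv_of_unit _ hs, mul_one]
    · intro hm
      rw [hm, mul_comm, mul_assoc, ZMod.inv_mul_of_unit _ hs, mul_one]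
  · refine sum_eq_zero fun m hm => ?_
    exfalso
    rw [mem_filter, Nat.cast_mul] at hm
    have hu : IsUnit ((s : ZMod q) * (m : ZMod q)) := hm.2 ▸ ha
    exact h ((ZMod.isUnit_iff_coprime s q).1 (isUnit_of_mul_isUnit_left hu))

/-- `∑_{m ≤ M, (sm, q) = 1} μ(m) = ∑_{m ≤ M, (m,q)=1} μ(m)` if `(s, q) = 1`, and `= 0` (empty) otherwise.
[folklore] -/
theorem inner_coprime_eq (q s M : ℕ) :
    ∑ m ∈ (Ioc 0 M).filter (fun m : ℕ => (s * m).Coprime q), (μ m : ℝ) =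
      if s.Coprime q then moebiusCoprimeSum M q else 0 := by
  split_ifs with h
  · rw [moebiusCoprimeSum, show Icc 1 M = Ioc 0 M from rfl]
    refine sum_congr (Finset.filter_congr fun m _ => ?_) fun _ _ => rfl
    rw [Nat.coprime_mul_iff_left]
    exact ⟨fun hm => hm.2, fun hm => ⟨h, hm⟩⟩
  · refine sum_eq_zero fun m hm => ?_
    exfalso
    rw [mem_filter] at hm
    exact h (Nat.Coprime.coprime_mul_right hm.2)

/-! ### `Δ_λ` as a sum of `Δ_μ` over the squares coprime to `q` -/

/-- **`Δ_λ(x; q, a) = ∑_{s ≤ x, s = □, (s,q)=1} Δ_μ(⌊x⌋/s; q, a s̄)`** for `(a, q) = 1`. [folklore] -/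
theorem liouvilleAPDelta_eq {x : ℝ} {q : ℕ} {a : ℤ} (ha : IsCoprime a q) :
    liouvilleAPDelta x q a = ∑ s ∈ Ioc 0 ⌊x⌋₊, (if IsSquare s then (1 : ℝ) else 0) *
      (if s.Coprime q then moebiusDisc (⌊x⌋₊ / s) q ((a : ZMod q) * ((s : ZMod q))⁻¹) else 0) := by
  have hau : IsUnit ((a : ZMod q)) := (ZMod.coe_int_isUnit_iff_isCoprime a q).2 ha.symm
  have hfilter : (Icc 1 ⌊x⌋₊).filter (fun n : ℕ => Int.ModEq q n a) =
      (Icc 1 ⌊x⌋₊).filter (fun n : ℕ => (n : ZMod q) = (a : ZMod q)) := by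
    refine Finset.filter_congr fun n _ => ?_
    rw [← Int.cast_natCast (R := ZMod q) n, ZMod.intCast_eq_intCast_iff]
  unfold liouvilleAPDelta
  rw [hfilter, sum_liouville_filter_eq (fun n : ℕ => (n : ZMod q) = (a : ZMod q)),
    sum_liouville_filter_eq (fun n : ℕ => n.Coprime q), mul_sum, ← sum_sub_distrib]
  refine sum_congr rfl fun s _ => ?_
  rw [inner_progression_eq hau, inner_coprime_eq]
  simp only [moebiusDisc]
  split_ifs <;> ring

/-- Hence `|Δ_λ(x; q, a)| ≤ ∑_{k ≤ √x} |Δ_μ(⌊x⌋/k²; q, sqResidue q a k²)|` for `(a, q) = 1`. [folklore] -/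
theorem abs_liouvilleAPDelta_le_sum_sq {x : ℝ} {q : ℕ} {a : ℤ} (ha : IsCoprime a q) :
    |liouvilleAPDelta x q a| ≤ ∑ k ∈ Ioc 0 (Nat.sqrt ⌊x⌋₊),
      |moebiusDisc (⌊x⌋₊ / (k * k)) q (sqResidue q (a : ZMod q) (k * k))| := by
  set N := ⌊x⌋₊ with hN
  set D : ℕ → ℝ := fun s => if s.Coprime q then moebiusDisc (N / s) q ((a : ZMod q) * ((s : ZMod q))⁻¹)
    else 0 with hD
  rw [liouvilleAPDelta_eq ha]
  refine (abs_sum_le_sum_abs _ _).trans ?_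
  have h1 : ∑ s ∈ Ioc 0 N, |(if IsSquare s then (1 : ℝ) else 0) * D s| =
      ∑ s ∈ (Ioc 0 N).filter IsSquare, |D s| := by
    rw [sum_filter]
    refine sum_congr rfl fun s _ => ?_
    split_ifs <;> simp
  rw [h1, filter_isSquare_Ioc_eq_image, sum_image]
  · refine sum_le_sum fun k _ => ?_
    simp only [hD, sqResidue]
    split_ifs
    · exact le_rfl
    · rw [abs_zero]; exact abs_nonneg _
  · intro k₁ _ k₂ _ h
    exact Nat.mul_self_inj.1 h

/-! ### Trivial bounds -/

/-- `#{1 ≤ m ≤ M : m ≡ b (q)} ≤ M/q + 1` (`m ↦ ⌊m/q⌋` is injective on a residue class; for `q = 0`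
both sides read `≤ 1`). [folklore] -/
theorem card_filter_natCast_eq_le {q : ℕ} (b : ZMod q) (M : ℕ) :
    #((Icc 1 M).filter (fun m : ℕ => (m : ZMod q) = b)) ≤ M / q + 1 := by
  calc #((Icc 1 M).filter (fun m : ℕ => (m : ZMod q) = b))
      ≤ #(range (M / q + 1)) := by
        refine Finset.card_le_card_of_injOn (fun m => m / q) (fun m hm => ?_) ?_
        · rw [Finset.mem_coe, mem_filter, mem_Icc] at hm
          rw [Finset.mem_coe, mem_range]
          exact Nat.lt_succ_of_le (Nat.div_le_div_right hm.1.2)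
        · intro m₁ hm₁ m₂ hm₂ h
          rw [Finset.mem_coe, mem_filter] at hm₁ hm₂
          have hmod : m₁ % q = m₂ % q := by
            have := hm₁.2.trans hm₂.2.symm
            exact (ZMod.natCast_eq_natCast_iff' m₁ m₂ q).1 this
          calc m₁ = q * (m₁ / q) + m₁ % q := (Nat.div_add_mod m₁ q).symm
            _ = q * (m₂ / q) + m₂ % q := by rw [show m₁ / q = m₂ / q from h, hmod]
            _ = m₂ := Nat.div_add_mod m₂ q
    _ = M / q + 1 := card_range _

/-- The trivial bound `|Δ_μ(M; q, b)| ≤ M/q + 1 + M/φ(q)`. [folklore] -/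
theorem abs_moebiusDisc_le_trivial (q M : ℕ) (b : ZMod q) :
    |moebiusDisc M q b| ≤ (M : ℝ) / q + 1 + (M : ℝ) * ((Nat.totient q : ℝ))⁻¹ := by
  have h1 : |moebiusAPSum M q b| ≤ (M : ℝ) / q + 1 := by
    unfold moebiusAPSum
    refine (abs_sum_le_sum_abs _ _).trans ?_
    calc ∑ m ∈ (Icc 1 M).filter (fun m : ℕ => (m : ZMod q) = b), |(μ m : ℝ)|
        ≤ ∑ _m ∈ (Icc 1 M).filter (fun m : ℕ => (m : ZMod q) = b), (1 : ℝ) :=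
          sum_le_sum fun m _ => by exact_mod_cast abs_moebius_le_one
      _ = #((Icc 1 M).filter (fun m : ℕ => (m : ZMod q) = b)) := by simp
      _ ≤ ((M / q + 1 : ℕ) : ℝ) := by exact_mod_cast card_filter_natCast_eq_le b M
      _ ≤ (M : ℝ) / q + 1 := by push_cast; gcongr; exact Nat.cast_div_le
  have h2 : |moebiusCoprimeSum M q| ≤ M := by
    unfold moebiusCoprimeSum
    refine (abs_sum_le_sum_abs _ _).trans ?_
    calc ∑ m ∈ (Icc 1 M).filter (fun m : ℕ => m.Coprime q), |(μ m : ℝ)|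
        ≤ ∑ _m ∈ (Icc 1 M).filter (fun m : ℕ => m.Coprime q), (1 : ℝ) :=
          sum_le_sum fun m _ => by exact_mod_cast abs_moebius_le_one
      _ ≤ ∑ _m ∈ Icc 1 M, (1 : ℝ) :=
          sum_le_sum_of_subset_of_nonneg (filter_subset _ _) fun _ _ _ => zero_le_one
      _ = M := by simp
  unfold moebiusDisc
  calc |moebiusAPSum M q b - ((Nat.totient q : ℝ))⁻¹ * moebiusCoprimeSum M q|
      ≤ |moebiusAPSum M q b| + |((Nat.totient q : ℝ))⁻¹ * moebiusCoprimeSum M q| := abs_sub _ _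
    _ = |moebiusAPSum M q b| + ((Nat.totient q : ℝ))⁻¹ * |moebiusCoprimeSum M q| := by
        have hφ0 : (0 : ℝ) ≤ ((Nat.totient q : ℝ))⁻¹ := inv_nonneg.2 (Nat.cast_nonneg _)
        rw [abs_mul, abs_of_nonneg hφ0]
    _ ≤ (M : ℝ) / q + 1 + ((Nat.totient q : ℝ))⁻¹ * M := by
        gcongr
    _ = _ := by ring

/-- Summing the trivial bound over `q ≤ Q`:
`∑_{q ≤ Q} |Δ_μ(M; q, b_q)| ≤ M (1 + log Q) + Q + M (1 + log Q)²`. [folklore] -/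
theorem sum_abs_moebiusDisc_le_trivial (Q M : ℕ) (b : (q : ℕ) → ZMod q) :
    ∑ q ∈ Icc 1 Q, |moebiusDisc M q (b q)| ≤
      (M : ℝ) * (1 + Real.log Q) + Q + (M : ℝ) * (1 + Real.log Q) ^ 2 := by
  calc ∑ q ∈ Icc 1 Q, |moebiusDisc M q (b q)|
      ≤ ∑ q ∈ Icc 1 Q, ((M : ℝ) * ((q : ℝ))⁻¹ + 1 + (M : ℝ) * ((Nat.totient q : ℝ))⁻¹) := by
        refine sum_le_sum fun q _ => ?_
        have h := abs_moebiusDisc_le_trivial q M (b q)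
        rwa [div_eq_mul_inv] at h
    _ = (M : ℝ) * ∑ q ∈ Icc 1 Q, ((q : ℝ))⁻¹ + Q + (M : ℝ) * totientInvSum Q := by
        rw [sum_add_distrib, sum_add_distrib, ← mul_sum, ← mul_sum, sum_const, Nat.card_Icc,
          Nat.add_sub_cancel, nsmul_eq_mul, mul_one, totientInvSum]
    _ ≤ (M : ℝ) * (1 + Real.log Q) + Q + (M : ℝ) * (1 + Real.log Q) ^ 2 := by
        gcongr
        · exact harmonic_Icc_le Q
        · exact totientInvSum_le Q

/-! ### The main estimate for large `x` -/

/-- Summing `abs_liouvilleAPDelta_le_sum_sq` over the moduli and swapping the sums. [folklore] -/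
theorem sum_abs_liouvilleAPDelta_le_sum (x : ℝ) (Q : ℕ) (a : ℕ → ℤ) (ha : ∀ q, IsCoprime (a q) q) :
    ∑ q ∈ Icc 1 Q, |liouvilleAPDelta x q (a q)| ≤
      ∑ k ∈ Ioc 0 (Nat.sqrt ⌊x⌋₊), ∑ q ∈ Icc 1 Q,
        |moebiusDisc (⌊x⌋₊ / (k * k)) q (sqResidue q (a q : ZMod q) (k * k))| := by
  rw [Finset.sum_comm]
  exact sum_le_sum fun q _ => abs_liouvilleAPDelta_le_sum_sq (ha q)

/-- `⌊x⌋/k² ≤ x/k²` (as reals), for `k ≥ 1`, `x ≥ 0`. [folklore] -/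
theorem cast_floor_div_sq_le {x : ℝ} (hx : 0 ≤ x) {k : ℕ} (hk : 1 ≤ k) :
    ((⌊x⌋₊ / (k * k) : ℕ) : ℝ) ≤ x / (k : ℝ) ^ 2 := by
  have hk0 : (0 : ℝ) < k := by exact_mod_cast hk
  calc ((⌊x⌋₊ / (k * k) : ℕ) : ℝ) ≤ (⌊x⌋₊ : ℝ) / ((k * k : ℕ) : ℝ) := Nat.cast_div_le
    _ ≤ x / (k : ℝ) ^ 2 := by
        push_cast
        rw [sq]
        exact div_le_div_of_nonneg_right (Nat.floor_le hx) (by positivity)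

set_option maxHeartbeats 800000 in
/-- **The estimate for large `x`.**  Assume the Bombieri–Vinogradov theorem for `μ` with saving
`(log x)^{−(2A+2)}` beyond `x₀` (the shape of `Literature.NumberTheory.Sieve.bombieriVinogradov_moebius`).
Then for `x ≥ x₀` with `log x ≥ 2`, `Q ≤ x^{1/2}(log x)^{−B_μ}` and `Q ≤ x^{1/2}`, and residues
`(a_q, q) = 1`:
`∑_{q ≤ Q} |Δ_λ(x; q, a_q)| ≤ (C_μ + 4) x/(log x)^A + x^{1/2} Q`
(the squares `k² ≤ (log x)^{2A+4}` by Bombieri–Vinogradov for `μ` at the cut-offs `⌊x⌋/k²`, the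
larger squares trivially). [folklore] -/
theorem sum_abs_liouvilleAPDelta_le_of_large {A Bμ Cμ x₀ : ℝ} (hA : 0 < A) (hCμ : 0 ≤ Cμ)
    (hBV : ∀ x : ℝ, x₀ ≤ x → ∀ Q : ℕ, (Q : ℝ) ≤ x ^ (1 / 2 : ℝ) / Real.log x ^ Bμ →
      ∀ N : ℕ → ℕ, (∀ q, (N q : ℝ) ≤ x) → ∀ b : (q : ℕ) → ZMod q, (∀ q ∈ Icc 1 Q, IsUnit (b q)) →
        ∑ q ∈ Icc 1 Q, |moebiusDisc (N q) q (b q)| ≤ Cμ * x / Real.log x ^ (2 * A + 2))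
    {x : ℝ} (hx₀ : x₀ ≤ x) (hx1 : 1 ≤ x) (hL : 2 ≤ Real.log x) {Q : ℕ}
    (hQ : (Q : ℝ) ≤ x ^ (1 / 2 : ℝ) / Real.log x ^ Bμ) (hQs : (Q : ℝ) ≤ x ^ (1 / 2 : ℝ))
    (a : ℕ → ℤ) (ha : ∀ q, IsCoprime (a q) q) :
    ∑ q ∈ Icc 1 Q, |liouvilleAPDelta x q (a q)| ≤
      (Cμ + 4) * x / Real.log x ^ A + x ^ (1 / 2 : ℝ) * Q := by
  have hx0 : 0 < x := by linarith
  set N := ⌊x⌋₊ with hNdef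
  set S := Nat.sqrt N with hSdef
  set L := Real.log x with hLdef
  set K₀ := ⌊L ^ (A + 2)⌋₊ with hK₀def
  set F : ℕ → ℝ := fun k => ∑ q ∈ Icc 1 Q,
    |moebiusDisc (N / (k * k)) q (sqResidue q (a q : ZMod q) (k * k))| with hFdef
  have hF0 : ∀ k, 0 ≤ F k := fun k => sum_nonneg fun _ _ => abs_nonneg _
  have hL0 : 0 < L := by linarith
  have hL1 : 1 ≤ L := by linarith
  have hLp : ∀ e : ℝ, 0 < L ^ e := fun e => Real.rpow_pos_of_pos hL0 e
  have hLA2 : L ^ (A + 2) = L ^ A * L ^ 2 := by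
    rw [Real.rpow_add hL0, show (2 : ℝ) = (2 : ℕ) by norm_num, Real.rpow_natCast]
  have hL2A2 : L ^ (2 * A + 2) = L ^ A * L ^ (A + 2) := by
    rw [← Real.rpow_add hL0]; congr 1; ring
  have hLA22 : 2 ≤ L ^ (A + 2) := by
    calc (2 : ℝ) ≤ L := hL
      _ = L ^ (1 : ℝ) := (Real.rpow_one L).symm
      _ ≤ L ^ (A + 2) := Real.rpow_le_rpow_of_exponent_le hL1 (by linarith)
  -- facts about `K₀`
  have hK₀le : (K₀ : ℝ) ≤ L ^ (A + 2) := Nat.floor_le (hLp _).le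
  have hK₀lt : L ^ (A + 2) < K₀ + 1 := Nat.lt_floor_add_one _
  have hK₀1 : 1 ≤ K₀ := Nat.le_floor (by norm_num; linarith)
  have hK₀0 : (0 : ℝ) < K₀ := by exact_mod_cast hK₀1
  have hK₀inv : (1 : ℝ) / K₀ ≤ 2 / L ^ (A + 2) := by
    rw [div_le_div_iff₀ hK₀0 (hLp _)]; linarith
  -- Bombieri–Vinogradov for each `k`
  have hFk : ∀ k, F k ≤ Cμ * x / L ^ (2 * A + 2) := by
    intro k
    refine hBV x hx₀ Q hQ (fun _ => N / (k * k)) (fun q => ?_)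
      (fun q => sqResidue q (a q : ZMod q) (k * k)) (fun q _ => ?_)
    · calc ((N / (k * k) : ℕ) : ℝ) ≤ N := by exact_mod_cast Nat.div_le_self N (k * k)
        _ ≤ x := Nat.floor_le hx0.le
    · exact isUnit_sqResidue ((ZMod.coe_int_isUnit_iff_isCoprime _ _).2 (ha q).symm) _
  -- the trivial bound for each `k ≥ 1`
  have hlogQ : 1 + Real.log Q ≤ L := by
    rcases Nat.eq_zero_or_pos Q with rfl | hQ0
    · simp; linarith
    · have hQ1 : (1 : ℝ) ≤ Q := by exact_mod_cast hQ0
      have h1 : Real.log Q ≤ Real.log (x ^ (1 / 2 : ℝ)) := Real.log_le_log (by linarith) hQs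
      rw [Real.log_rpow hx0] at h1
      linarith
  have hlogQ0 : 0 ≤ 1 + Real.log Q := by
    have : 0 ≤ Real.log (Q : ℝ) := Real.log_natCast_nonneg Q; linarith
  have hFk' : ∀ k, 1 ≤ k → F k ≤ 2 * (x * (1 / (k : ℝ) ^ 2)) * L ^ 2 + Q := by
    intro k hk
    have hM := cast_floor_div_sq_le hx0.le hk
    have hM0 : (0 : ℝ) ≤ ((N / (k * k) : ℕ) : ℝ) := Nat.cast_nonneg _
    have hxk : 0 ≤ x / (k : ℝ) ^ 2 := by positivity
    refine (sum_abs_moebiusDisc_le_trivial Q (N / (k * k)) _).trans ?_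
    have h1 : ((N / (k * k) : ℕ) : ℝ) * (1 + Real.log Q) ≤ x / (k : ℝ) ^ 2 * L :=
      mul_le_mul hM hlogQ hlogQ0 hxk
    have h2 : ((N / (k * k) : ℕ) : ℝ) * (1 + Real.log Q) ^ 2 ≤ x / (k : ℝ) ^ 2 * L ^ 2 :=
      mul_le_mul hM (pow_le_pow_left₀ hlogQ0 hlogQ 2) (by positivity) hxk
    have h3 : x / (k : ℝ) ^ 2 * L ≤ x / (k : ℝ) ^ 2 * L ^ 2 :=
      mul_le_mul_of_nonneg_left (by nlinarith) hxk
    have e : x * (1 / (k : ℝ) ^ 2) = x / (k : ℝ) ^ 2 := by ring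
    rw [e]
    linarith
  -- splitting the sum over `k` at `K₀`
  have hsplit : ∑ k ∈ Ioc 0 S, F k ≤ ∑ k ∈ Ioc 0 K₀, F k + ∑ k ∈ Ioc K₀ S, F k := by
    rcases le_or_gt K₀ S with h | h
    · rw [← sum_Ioc_consecutive F (Nat.zero_le K₀) h]
    · have he : Ioc K₀ S = ∅ := Finset.Ioc_eq_empty (by omega)
      rw [he, sum_empty, add_zero]
      exact sum_le_sum_of_subset_of_nonneg (Ioc_subset_Ioc_right h.le) fun k _ _ => hF0 k
  -- the small squares
  have hmain : ∑ k ∈ Ioc 0 K₀, F k ≤ Cμ * x / L ^ A := by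
    calc ∑ k ∈ Ioc 0 K₀, F k ≤ ∑ _k ∈ Ioc 0 K₀, Cμ * x / L ^ (2 * A + 2) :=
          sum_le_sum fun k _ => hFk k
      _ = K₀ * (Cμ * x / L ^ (2 * A + 2)) := by
          rw [sum_const, Nat.card_Ioc, Nat.sub_zero, nsmul_eq_mul]
      _ ≤ L ^ (A + 2) * (Cμ * x / L ^ (2 * A + 2)) :=
          mul_le_mul_of_nonneg_right hK₀le (by positivity)
      _ = Cμ * x / L ^ A := by
          rw [hL2A2]; field_simp
  -- the large squares
  have hS : (S : ℝ) ≤ x ^ (1 / 2 : ℝ) := by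
    have hSS : ((S * S : ℕ) : ℝ) ≤ N := by exact_mod_cast Nat.sqrt_le N
    push_cast at hSS
    have hS2 : (S : ℝ) ^ 2 ≤ x := by
      calc (S : ℝ) ^ 2 = (S : ℝ) * S := sq _
        _ ≤ N := hSS
        _ ≤ x := Nat.floor_le hx0.le
    rw [← Real.sqrt_eq_rpow]
    calc (S : ℝ) = Real.sqrt ((S : ℝ) ^ 2) := (Real.sqrt_sq (Nat.cast_nonneg S)).symm
      _ ≤ Real.sqrt x := Real.sqrt_le_sqrt hS2
  have htail : ∑ k ∈ Ioc K₀ S, F k ≤ 4 * x / L ^ A + x ^ (1 / 2 : ℝ) * Q := by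
    calc ∑ k ∈ Ioc K₀ S, F k ≤ ∑ k ∈ Ioc K₀ S, (2 * (x * (1 / (k : ℝ) ^ 2)) * L ^ 2 + Q) :=
          sum_le_sum fun k hk => hFk' k (by have := (mem_Ioc.1 hk).1; omega)
      _ = 2 * x * L ^ 2 * ∑ k ∈ Ioc K₀ S, (1 / (k : ℝ) ^ 2) + #(Ioc K₀ S) * (Q : ℝ) := by
          rw [sum_add_distrib, sum_const, nsmul_eq_mul, mul_sum]
          congr 1
          exact sum_congr rfl fun k _ => by ring
      _ ≤ 2 * x * L ^ 2 * (1 / K₀) + S * (Q : ℝ) := by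
          gcongr
          · exact sum_Ioc_inv_sq_le hK₀1 S
          · rw [Nat.card_Ioc]; exact_mod_cast Nat.sub_le S K₀
      _ ≤ 2 * x * L ^ 2 * (2 / L ^ (A + 2)) + x ^ (1 / 2 : ℝ) * Q := by
          gcongr
      _ = 4 * x / L ^ A + x ^ (1 / 2 : ℝ) * Q := by
          rw [hLA2]; field_simp; ring
  calc ∑ q ∈ Icc 1 Q, |liouvilleAPDelta x q (a q)| ≤ ∑ k ∈ Ioc 0 S, F k :=
        sum_abs_liouvilleAPDelta_le_sum x Q a ha
    _ ≤ Cμ * x / L ^ A + (4 * x / L ^ A + x ^ (1 / 2 : ℝ) * Q) :=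
        hsplit.trans (add_le_add hmain htail)
    _ = (Cμ + 4) * x / L ^ A + x ^ (1 / 2 : ℝ) * Q := by ring

/-- The trivial bound summed: `∑_{q ≤ Q} |Δ_λ(x; q, a_q)| ≤ 2 x Q` (`x ≥ 0`), from the tree's
`Literature.NumberTheory.Sieve.abs_liouvilleAPDelta_le` (`|Δ_λ(x; q, a)| ≤ 2x`). [folklore] -/
theorem sum_abs_liouvilleAPDelta_le_trivial {x : ℝ} (hx : 0 ≤ x) (Q : ℕ) (a : ℕ → ℤ) :
    ∑ q ∈ Icc 1 Q, |liouvilleAPDelta x q (a q)| ≤ 2 * x * Q := by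
  calc ∑ q ∈ Icc 1 Q, |liouvilleAPDelta x q (a q)| ≤ ∑ _q ∈ Icc 1 Q, 2 * x :=
        sum_le_sum fun q _ => Literature.NumberTheory.Sieve.abs_liouvilleAPDelta_le hx q (a q)
    _ = 2 * x * Q := by
        rw [sum_const, Nat.card_Icc, Nat.add_sub_cancel, nsmul_eq_mul]; ring

end FTLiouville

open Finset FTLiouville

/-- **Fouvry–Tenenbaum 2021, Theorem 1.8, for `f = λ`, PROVED**: the Bombieri–Vinogradov theorem for
the Liouville function at level `x^{1/2} ℒ^{−B}` (`ℒ = log 3x`), i.e. the named fact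
`Literature.NumberTheory.Sieve.FouvryTenenbaum2021_thm18_liouville`.  Proof: `λ = 𝟙_□ ⋆ μ` reduces
`Δ_λ(x; q, a)` to `∑_{k ≤ √x, (k,q)=1} Δ_μ(⌊x⌋/k²; q, a k̄²)` (`abs_liouvilleAPDelta_le_sum_sq`); the squares
`k ≤ (log x)^{A+2}` are handled by the Bombieri–Vinogradov theorem for `μ`
(`Literature.NumberTheory.Sieve.bombieriVinogradov_moebius`, saving `(log x)^{2A+2}`), the larger
squares trivially (`∑_{k > K} x/k² ≤ x/K`); bounded `x` are absorbed into the constant.  The printed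
proof (FT §8) proceeds differently (see `BombieriVinogradovMoebius.lean`).
[cite: FouvryTenenbaum2021, Theorem 1.8 (f = λ, D = 1)] -/
theorem FouvryTenenbaum2021_thm18_liouville_holds : FouvryTenenbaum2021_thm18_liouville := by
  intro A hA
  obtain ⟨Bμ, Cμ, x₀, hBμ, hCμ, hBV⟩ := bombieriVinogradov_moebius (2 * A + 2) (by positivity)
  -- the threshold beyond which the main estimate applies
  set x₁ : ℝ := max (max x₀ 1) (Real.exp 2) with hx₁def
  have hx₁1 : 1 ≤ x₁ := le_trans (le_max_right _ _) (le_max_left _ _)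
  have hx₁0 : 0 < x₁ := by linarith
  set B : ℝ := max Bμ A with hBdef
  have hB0 : 0 < B := lt_of_lt_of_le hBμ (le_max_left _ _)
  set C₁ : ℝ := (Cμ + 4) * 2 ^ A + 1 with hC₁def
  set C₂ : ℝ := 2 * x₁ ^ (1 / 2 : ℝ) * Real.log (3 * x₁) ^ A with hC₂def
  have hC₁0 : 0 ≤ C₁ := by positivity
  have hlog3x₁ : 1 ≤ Real.log (3 * x₁) := by
    rw [Real.le_log_iff_exp_le (by positivity)]
    have := Real.exp_one_lt_d9
    nlinarith
  have hC₂0 : 0 ≤ C₂ := by positivity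
  refine ⟨B, max C₁ C₂, fun x hx Q hQ a ha => ?_⟩
  have hx0 : 0 < x := by linarith
  have hlog3x : 1 < Real.log (3 * x) := by
    rw [Real.lt_log_iff_exp_lt (by positivity)]
    have := Real.exp_one_lt_d9
    nlinarith
  have hlog3x0 : 0 < Real.log (3 * x) := by linarith
  have hL3B : 1 ≤ Real.log (3 * x) ^ B := Real.one_le_rpow hlog3x.le hB0.le
  have hRHS0 : 0 ≤ max C₁ C₂ * x / Real.log (3 * x) ^ A := by positivity
  -- the moduli actually summed: `Q' = ⌊Q⌋ ≤ x^{1/2} / log(3x)^B ≤ x^{1/2}`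
  set Q' := ⌊Q⌋₊ with hQ'def
  rcases lt_or_ge Q 0 with hQneg | hQ0
  · rw [hQ'def, Nat.floor_of_nonpos hQneg.le, show Icc 1 0 = (∅ : Finset ℕ) by rfl, sum_empty]
    exact hRHS0
  have hQ'le : (Q' : ℝ) ≤ x ^ (1 / 2 : ℝ) / Real.log (3 * x) ^ B := (Nat.floor_le hQ0).trans hQ
  have hQ's : (Q' : ℝ) ≤ x ^ (1 / 2 : ℝ) := hQ'le.trans (div_le_self (by positivity) hL3B)
  rcases lt_or_ge x x₁ with hsmall | hlarge
  · -- bounded `x`: the trivial bound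
    have h1 : ∑ q ∈ Icc 1 Q', |liouvilleAPDelta x q (a q)| ≤ 2 * x * x₁ ^ (1 / 2 : ℝ) := by
      refine (sum_abs_liouvilleAPDelta_le_trivial hx0.le Q' a).trans ?_
      have : (Q' : ℝ) ≤ x₁ ^ (1 / 2 : ℝ) :=
        hQ's.trans (Real.rpow_le_rpow hx0.le hsmall.le (by norm_num))
      exact mul_le_mul_of_nonneg_left this (by positivity)
    have h2 : Real.log (3 * x) ^ A ≤ Real.log (3 * x₁) ^ A :=
      Real.rpow_le_rpow hlog3x0.le (Real.log_le_log (by positivity) (by linarith)) hA.le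
    have h3 : 2 * x * x₁ ^ (1 / 2 : ℝ) ≤ C₂ * x / Real.log (3 * x) ^ A := by
      rw [le_div_iff₀ (Real.rpow_pos_of_pos hlog3x0 A), hC₂def]
      have hx2 : 0 ≤ 2 * x * x₁ ^ (1 / 2 : ℝ) := by positivity
      calc 2 * x * x₁ ^ (1 / 2 : ℝ) * Real.log (3 * x) ^ A
          ≤ 2 * x * x₁ ^ (1 / 2 : ℝ) * Real.log (3 * x₁) ^ A := mul_le_mul_of_nonneg_left h2 hx2
        _ = 2 * x₁ ^ (1 / 2 : ℝ) * Real.log (3 * x₁) ^ A * x := by ring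
    calc _ ≤ 2 * x * x₁ ^ (1 / 2 : ℝ) := h1
      _ ≤ C₂ * x / Real.log (3 * x) ^ A := h3
      _ ≤ max C₁ C₂ * x / Real.log (3 * x) ^ A := by
          gcongr; exact le_max_right _ _
  · -- large `x`
    have hxx₀ : x₀ ≤ x := le_trans (le_trans (le_max_left _ _) (le_max_left _ _)) hlarge
    have hxe : Real.exp 2 ≤ x := le_trans (le_max_right _ _) hlarge
    have hL2 : 2 ≤ Real.log x := (Real.le_log_iff_exp_le hx0).2 hxe
    have hL1 : 1 ≤ Real.log x := by linarith
    have hL0 : 0 < Real.log x := by linarith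
    have hlogle : Real.log x ≤ Real.log (3 * x) := Real.log_le_log hx0 (by linarith)
    have hlog3le : Real.log (3 * x) ≤ 2 * Real.log x := by
      rw [Real.log_mul (by norm_num) hx0.ne']
      have : Real.log 3 ≤ 2 := by
        rw [Real.log_le_iff_le_exp (by norm_num)]
        have := Real.exp_one_gt_d9
        nlinarith [Real.add_one_le_exp (2 : ℝ)]
      linarith
    -- `Q' ≤ x^{1/2} / (log x)^{Bμ}`
    have hQ'μ : (Q' : ℝ) ≤ x ^ (1 / 2 : ℝ) / Real.log x ^ Bμ := by
      refine hQ'le.trans (div_le_div_of_nonneg_left (by positivity) (Real.rpow_pos_of_pos hL0 _) ?_)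
      calc Real.log x ^ Bμ ≤ Real.log x ^ B := Real.rpow_le_rpow_of_exponent_le hL1 (le_max_left _ _)
        _ ≤ Real.log (3 * x) ^ B := Real.rpow_le_rpow hL0.le hlogle hB0.le
    have hmainest := sum_abs_liouvilleAPDelta_le_of_large hA hCμ hBV hxx₀ hx hL2 hQ'μ hQ's a ha
    -- `(log 3x)^A ≤ 2^A (log x)^A`
    have hpowA : Real.log (3 * x) ^ A ≤ 2 ^ A * Real.log x ^ A := by
      rw [← Real.mul_rpow (by norm_num) hL0.le]
      exact Real.rpow_le_rpow hlog3x0.le hlog3le hA.le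
    have hLA : 0 < Real.log x ^ A := Real.rpow_pos_of_pos hL0 A
    have hL3A : 0 < Real.log (3 * x) ^ A := Real.rpow_pos_of_pos hlog3x0 A
    have t1 : (Cμ + 4) * x / Real.log x ^ A ≤ (Cμ + 4) * 2 ^ A * x / Real.log (3 * x) ^ A := by
      rw [div_le_div_iff₀ hLA hL3A]
      calc (Cμ + 4) * x * Real.log (3 * x) ^ A ≤ (Cμ + 4) * x * (2 ^ A * Real.log x ^ A) :=
            mul_le_mul_of_nonneg_left hpowA (by positivity)
        _ = (Cμ + 4) * 2 ^ A * x * Real.log x ^ A := by ring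
    have t2 : x ^ (1 / 2 : ℝ) * Q' ≤ x / Real.log (3 * x) ^ A := by
      calc x ^ (1 / 2 : ℝ) * Q' ≤ x ^ (1 / 2 : ℝ) * (x ^ (1 / 2 : ℝ) / Real.log (3 * x) ^ B) :=
            mul_le_mul_of_nonneg_left hQ'le (by positivity)
        _ = x / Real.log (3 * x) ^ B := by
            rw [← mul_div_assoc, ← Real.rpow_add hx0]; norm_num
        _ ≤ x / Real.log (3 * x) ^ A :=
            div_le_div_of_nonneg_left hx0.le hL3A
              (Real.rpow_le_rpow_of_exponent_le hlog3x.le (le_max_right _ _))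
    calc _ ≤ (Cμ + 4) * x / Real.log x ^ A + x ^ (1 / 2 : ℝ) * Q' := hmainest
      _ ≤ (Cμ + 4) * 2 ^ A * x / Real.log (3 * x) ^ A + x / Real.log (3 * x) ^ A := add_le_add t1 t2
      _ = C₁ * x / Real.log (3 * x) ^ A := by rw [hC₁def]; ring
      _ ≤ max C₁ C₂ * x / Real.log (3 * x) ^ A := by
          gcongr; exact le_max_left _ _

end Literature.NumberTheory.Sieve
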